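import Summits.PneNP.PneNP.Theses.ChebyshevTracialDesign
import Literature.Combinatorics.Optimization.ChebyshevExtrapolationDesign
import HarnessLib

/-!
# Route `ChebyshevTracialDesign`, crux `ChebyshevDesign20`: closed by the explicit design

The route item `Summit.PneNP.PneNP.Theses.ChebyshevTracialDesign.ChebyshevDesign20` is the named
statement `Literature.Combinatorics.Optimization.ChebyshevDesignExistsBal 20` (balanced exact
extrapolation designs of degree `dq n` on odd levels `≤ Tq n` with total variation `≤ 20`, for all
large even `n`), PROVED in the tree as
`Literature.Combinatorics.Optimization.chebyshevDesignExistsBal_twenty`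
(`Literature/Combinatorics/Optimization/ChebyshevExtrapolationDesign.lean`: nodes `3 + 4 s j²`,
Lagrange extrapolation weights, the factorial identity for the variation bound). Nothing is
re-proved here (D-0059).
-/

set_option linter.dupNamespace false -- `Summit.PneNP.PneNP.…`: summit = sub-problem (D-0017)

namespace Summit.PneNP.PneNP.Theorems

/-- **Crux `ChebyshevDesign20` of route `ChebyshevTracialDesign`** — by the tree theorem
`Literature.Combinatorics.Optimization.chebyshevDesignExistsBal_twenty`.
[cite: CoppersmithRivlin1992, Thm. (p. 970)] -/
theorem ChebyshevDesign20_proof : Summit.PneNP.PneNP.Theses.ChebyshevTracialDesign.ChebyshevDesign20 :=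
  Literature.Combinatorics.Optimization.chebyshevDesignExistsBal_twenty

end Summit.PneNP.PneNP.Theorems
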